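import Literature.Probability.Percolation.QuadCrossingRotationInvarianceOfCoupling
import Literature.Probability.Percolation.LoopRepresentation
import HarnessLib

/-!
# DKKMO Cor. 1.3 (`q = 1`) from Theorem 1.2 (`d_CN` form) plus a deterministic transfer
# (proved reduction; the probabilistic assembly of the printed proof line)

Topic `Probability/Percolation`; fourth sibling proofs file of
`QuadCrossingRotationInvariance.lean`, whose named fact `dkkmo_crossing_rotation_invariance`
vendors Duminil-Copin–Kozlowski–Krachun–Manolescu–Oulamara, arXiv:2012.11672v1, Corollary 1.3
at `q = 1` (per quad `Q` and `ε > 0`: for `α ∈ (ε, π - ε)` and `δ < δ₀(Q, ε)`,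
`|P_{1/2}[𝒞_δ(e^{iα}Q)] - P_{1/2}[𝒞_δ(Q)]| ≤ ε`).

The printed proof (§7.1, p. 43: "the result follows directly from Theorem 1.2 and the
measurability of `𝒞(Q)` in the Schramm–Smirnov topology") combines

* Theorem 1.2 — in the tree the `d_CN` (Camia–Newman loop-metric) half, the named fact
  `dkkmo_theorem_1_2` of `LoopRepresentation.lean`, in coupling form
  `dkkmo_theorem_1_2.exists_coupling`: for `α ∈ [0, 2π]`, `δ > 0`, `ε' > C δ^c` a coupling `ℙ` of
  two critical bond percolations `ω`, `ω'` with
  `ℙ[¬ d_CN(loops of ω on δℤ², loops of ω' on e^{iα}δℤ²) ≤ ε'] < ε'`;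
* the passage from closeness of loop configurations to agreement of the crossing indicator of the
  fixed quad `Q` off an event of small probability (the `d_SS` half of Theorem 1.2 read on one
  quad; DKKMO, §5 p. 25: "follows readily from known implications between the former and the
  latter", Camia–Newman 2006; Schramm–Smirnov 2011 §5–6 for the continuity of `𝒞(Q)`).

This file proves the **probabilistic assembly** of that line, leaving the second ingredient as
an explicit hypothesis `H` of the precise shape a proof must deliver (no named fact is introduced,
D-0026): for every quad `R` and `ε > 0` there are `η > 0`, `δ₁ > 0` such that for every rotation
`Q = e^{iβ}R`, every angle `α` and every `δ ∈ (0, δ₁)` there are events `G`, `Rg` with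

* (small complements, *uniformly over the rotations of the quad*) `P_{1/2}[𝒞_δ(Q) ∖ G] ≤ ε` and
  `P_{1/2}[Rgᶜ] ≤ ε` (Schramm–Smirnov 2011, Lemma 6.1-type continuity of `𝒞(Q)` plus arm
  estimates; the inputs are RSW bounds in round annuli, which do not see the rotation);
* (a *deterministic transfer*) if `ω` crosses `Q` at mesh `δ` and `ω ∈ G` (robust crossing,
  boundary regularity, crossing cluster inside the window `B(0, 1/η)`, …), if `ω' ∈ Rg`, and if
  the typed loop configurations of `ω` on `δℤ²` and of `ω'` on `e^{iα}δℤ²` satisfy `d_CN ≤ η`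
  (`LoopConfig.IsClose η`), then `ω'` drawn on `e^{iα}δℤ²` crosses `Q`, i.e. `ω'` crosses
  `e^{-iα}Q` at mesh `δ` (`quadCrossing (rotateQuad (-α) Q) δ`).

From `H` and `dkkmo_theorem_1_2` the fact follows (`dkkmo_crossing_rotation_invariance_of_transfer`):

1. `quadCrossingProb_le_of_transfer` — under a coupling `ℙ` with `ℙ[¬ close] < ε' ≤ η`, the union
   bound `{ω crosses Q} ⊆ ({ω crosses Q, ω ∈ G} ∩ {ω' ∈ Rg} ∩ {close}) ∪ {ω ∈ 𝒞 ∖ G} ∪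
   {ω' ∉ Rg} ∪ {¬ close}` and the transfer give
   `P[𝒞_δ(Q)] ≤ P[𝒞_δ(e^{-iα}Q)] + P[𝒞_δ(Q) ∖ G] + P[Rgᶜ] + ε'`
   (marginal events of possibly non-measurable sets are compared through `Measure.le_map_apply`,
   so no measurability of `G`, `Rg` is needed; `𝒞_δ(Q)` is measurable, `measurableSet_quadCrossing`);
2. `dkkmo_crossing_rotation_invariance_of_lower_bound` — the **one-sided bound suffices**: if
   `P[𝒞_δ(e^{iβ}R)] - ε ≤ P[𝒞_δ(e^{-iα}e^{iβ}R)]` for all `β`, all `α ∈ [0, 2π]` and `δ < δ₀(R, ε)`,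
   then `|P[𝒞_δ(e^{iα}R)] - P[𝒞_δ(R)]| ≤ ε` for `α ∈ (ε, π - ε)` (`β = α` gives the upper bound,
   `β = 0` with the angle `2π - α` and the `2π`-periodicity
   `quadCrossingProb_rotateQuad_add_int_mul_pi_div_two` the lower bound) — no duality is used;
3. the assembly: `ε/3` for each error term, `ε' = min η (ε/3)`, and `δ₀ = min δ₁ δ₂` with
   `C δ₂^c < ε'` (`exists_pos_forall_mul_rpow_lt`).

What is NOT here: the hypothesis `H` itself (the loops ↔ clusters dictionary for interface loops
of `ℤ²` in a general Jordan quad, and the Schramm–Smirnov continuity of `𝒞(Q)` for bond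
percolation on `δℤ²`), and `dkkmo_theorem_1_2` (undischarged; it is `dkkmo_theorem_1_7` modulo
the proved `dkkmo_theorem_1_2_of_theorem_1_7`).

## References

* [DKKMO2020Rotational] H. Duminil-Copin, K. K. Kozlowski, D. Krachun, I. Manolescu,
  M. Oulamara, *Rotational invariance in critical planar lattice models*, arXiv:2012.11672v1
  (2020): Thm. 1.2 and Cor. 1.3 p. 5, §5 p. 25 (d_CN vs d_SS), §7.1 p. 43 (proof of Cor. 1.3);
  v2: Thm. 1.2 (`d_CN ≤ C δ^c`, all angles).
* [SchrammSmirnov2011] O. Schramm, S. Smirnov, Ann. Probab. 39 (2011), arXiv:1101.5820, §5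
  (Lemma 5.1), §6 (Lemma 6.1).
* [CamiaNewman2006] F. Camia, C. M. Newman, Comm. Math. Phys. 268 (2006), §2, §5–7.
-/

noncomputable section

open MeasureTheory Set
open Literature.Probability.LatticeModels Literature.Probability.RandomPlanarGeometry

namespace Literature.Probability.Percolation

/-! ### The one-sided, rotation-uniform bound suffices -/

/-- **The one-sided bound suffices.** Suppose that for every quad `R` and `ε > 0` there is
`δ₀ > 0` such that for every rotation `e^{iβ}R` of `R`, every angle `α ∈ [0, 2π]` and every mesh
`δ ∈ (0, δ₀)`, `P_{1/2}[𝒞_δ(e^{iβ}R)] - ε ≤ P_{1/2}[𝒞_δ(e^{-iα} e^{iβ}R)]` (the crossing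
probability does not DROP by more than `ε` under rotation, uniformly over the rotations of the
quad). Then `dkkmo_crossing_rotation_invariance` holds: for `α ∈ (ε, π - ε)`, `β = α` gives
`P[𝒞_δ(e^{iα}R)] - ε ≤ P[𝒞_δ(R)]`, and `β = 0` with the angle `2π - α ∈ [0, 2π]` gives
`P[𝒞_δ(R)] - ε ≤ P[𝒞_δ(e^{i(α - 2π)}R)] = P[𝒞_δ(e^{iα}R)]`.
[cite: DKKMO2020Rotational, Cor. 1.3 (q = 1), proof §7.1 p. 43] -/
theorem dkkmo_crossing_rotation_invariance_of_lower_bound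
    (H : ∀ (R : ConformalRectangle) (ε : ℝ), 0 < ε → ∃ δ₀ : ℝ, 0 < δ₀ ∧
      ∀ β : ℝ, ∀ α ∈ Set.Icc (0 : ℝ) (2 * Real.pi), ∀ δ ∈ Set.Ioo (0 : ℝ) δ₀,
        quadCrossingProb δ (rotateQuad β R) - ε ≤
          quadCrossingProb δ (rotateQuad (-α) (rotateQuad β R))) :
    dkkmo_crossing_rotation_invariance := by
  intro R ε hε
  obtain ⟨δ₀, hδ₀, h⟩ := H R ε hε
  refine ⟨δ₀, hδ₀, fun α hα δ hδ => ?_⟩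
  have hαI : α ∈ Set.Icc (0 : ℝ) (2 * Real.pi) :=
    ⟨(hε.trans hα.1).le, by linarith [hα.2, Real.pi_pos]⟩
  have hα'I : 2 * Real.pi - α ∈ Set.Icc (0 : ℝ) (2 * Real.pi) :=
    ⟨by linarith [hα.2, Real.pi_pos], by linarith [hε.trans hα.1]⟩
  -- upper bound: rotate `e^{iα}R` back by `-α`
  have hup := h α α hαI δ hδ
  rw [← rotateQuad_add, add_neg_cancel, rotateQuad_zero] at hup
  -- lower bound: rotate `R = e^{i0}R` by `-(2π - α)`, an angle congruent to `α` modulo `2π`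
  have hlow := h 0 (2 * Real.pi - α) hα'I δ hδ
  rw [rotateQuad_zero, show -(2 * Real.pi - α) = α + ((-4 : ℤ) : ℝ) * (Real.pi / 2) by
    push_cast; ring, quadCrossingProb_rotateQuad_add_int_mul_pi_div_two] at hlow
  rw [abs_sub_le_iff]
  constructor <;> linarith

/-! ### One quad under one coupling: the union bound -/

/-- A marginal bound through a coupling without measurability of the event: if the first
marginal of `P` is `μ`, then `P[p.1 ∈ s] ≤ μ[s]` for every set `s` (`Measure.le_map_apply`).
[folklore] -/
theorem measureReal_preimage_fst_le_of_map_eq {X : Type*} [MeasurableSpace X]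
    {P : Measure (X × X)} {μ : Measure X} [IsFiniteMeasure μ] (h : P.map Prod.fst = μ)
    (s : Set X) : P.real (Prod.fst ⁻¹' s) ≤ μ.real s := by
  have h' : P (Prod.fst ⁻¹' s) ≤ μ s := by
    rw [← h]
    exact Measure.le_map_apply measurable_fst.aemeasurable s
  exact ENNReal.toReal_mono (measure_ne_top μ s) h'

/-- The same for the second marginal. [folklore] -/
theorem measureReal_preimage_snd_le_of_map_eq {X : Type*} [MeasurableSpace X]
    {P : Measure (X × X)} {ν : Measure X} [IsFiniteMeasure ν] (h : P.map Prod.snd = ν)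
    (s : Set X) : P.real (Prod.snd ⁻¹' s) ≤ ν.real s := by
  have h' : P (Prod.snd ⁻¹' s) ≤ ν s := by
    rw [← h]
    exact Measure.le_map_apply measurable_snd.aemeasurable s
  exact ENNReal.toReal_mono (measure_ne_top ν s) h'

/-- **One quad under one coupling.** Let `ℙ` couple two critical bond percolations `ω`, `ω'` so
that the typed loop configurations of `ω` on `δℤ²` and of `ω'` on `e^{iα}δℤ²` fail to satisfy
`d_CN ≤ ε'` with probability `< ε'`, where `0 < ε' ≤ η`. If crossings of `Q` by good
configurations transfer deterministically to crossings of `e^{-iα}Q` by regular loop-close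
configurations (`htr`), then
`P[𝒞_δ(Q)] ≤ P[𝒞_δ(e^{-iα}Q)] + P[𝒞_δ(Q) ∖ Good] + P[Regᶜ] + ε'`
(union bound; the crossing events are measurable, `measurableSet_quadCrossing`, the other two
marginal events are bounded through `Measure.le_map_apply`).
[cite: DKKMO2020Rotational, Thm. 1.2 and Cor. 1.3 (q = 1), proof §7.1 p. 43] -/
theorem quadCrossingProb_le_of_transfer {Q : ConformalRectangle} {δ η ε' α : ℝ} (hδ : 0 < δ)
    (hε' : 0 < ε') (hle : ε' ≤ η) (G Rg : Set (BondConfig (Site 2)))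
    (htr : ∀ ω ω' : BondConfig (Site 2), ω ∈ quadCrossing Q δ → ω ∈ G → ω' ∈ Rg →
      LoopConfig.IsClose η (bondLoopConfig δ 0 ω) (bondLoopConfig δ α ω') →
      ω' ∈ quadCrossing (rotateQuad (-α) Q) δ)
    (P : Measure (BondConfig (Site 2) × BondConfig (Site 2)))
    (h₁ : P.map Prod.fst = bondPercolation (zdGraph 2) half)
    (h₂ : P.map Prod.snd = bondPercolation (zdGraph 2) half)
    (hP : P {p | ¬ LoopConfig.IsClose ε' (bondLoopConfig δ 0 p.1) (bondLoopConfig δ α p.2)} <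
      ENNReal.ofReal ε') :
    quadCrossingProb δ Q ≤ quadCrossingProb δ (rotateQuad (-α) Q) +
      (bondPercolation (zdGraph 2) half).real (quadCrossing Q δ \ G) +
      (bondPercolation (zdGraph 2) half).real Rgᶜ + ε' := by
  haveI : IsProbabilityMeasure P := isProbabilityMeasure_of_map_fst h₁
  set A : Set (BondConfig (Site 2)) := quadCrossing Q δ with hAdef
  set A' : Set (BondConfig (Site 2)) := quadCrossing (rotateQuad (-α) Q) δ with hA'def
  set Cl : Set (BondConfig (Site 2) × BondConfig (Site 2)) :=
    {p | LoopConfig.IsClose ε' (bondLoopConfig δ 0 p.1) (bondLoopConfig δ α p.2)}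
  -- the transfer, as an inclusion of events of the coupling
  have hsub : Prod.fst ⁻¹' A ⊆
      ((Prod.snd ⁻¹' A' ∪ Prod.fst ⁻¹' (A \ G)) ∪ Prod.snd ⁻¹' Rgᶜ) ∪ Clᶜ := by
    rintro ⟨ω, ω'⟩ hA
    by_cases hG : ω ∈ G
    · by_cases hR : ω' ∈ Rg
      · by_cases hC : (ω, ω') ∈ Cl
        · exact Or.inl (Or.inl (Or.inl (htr ω ω' hA hG hR (LoopConfig.IsClose.mono hε' hle hC))))
        · exact Or.inr hC
      · exact Or.inl (Or.inr hR)
    · exact Or.inl (Or.inl (Or.inr ⟨hA, hG⟩))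
  have hPA : P.real (Prod.fst ⁻¹' A) = quadCrossingProb δ Q := by
    rw [quadCrossingProb, ← h₁, map_measureReal_apply measurable_fst
      (measurableSet_quadCrossing Q hδ), hAdef]
  have hPA' : P.real (Prod.snd ⁻¹' A') = quadCrossingProb δ (rotateQuad (-α) Q) := by
    rw [quadCrossingProb, ← h₂, map_measureReal_apply measurable_snd
      (measurableSet_quadCrossing _ hδ), hA'def]
  have hPG : P.real (Prod.fst ⁻¹' (A \ G)) ≤ (bondPercolation (zdGraph 2) half).real (A \ G) :=
    measureReal_preimage_fst_le_of_map_eq h₁ _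
  have hPR : P.real (Prod.snd ⁻¹' Rgᶜ) ≤ (bondPercolation (zdGraph 2) half).real Rgᶜ :=
    measureReal_preimage_snd_le_of_map_eq h₂ _
  have hPC : P.real Clᶜ < ε' := by
    have : Clᶜ = {p | ¬ LoopConfig.IsClose ε' (bondLoopConfig δ 0 p.1) (bondLoopConfig δ α p.2)} :=
      rfl
    rw [measureReal_def, this]
    exact ENNReal.toReal_lt_of_lt_ofReal hP
  have hbound : P.real (Prod.fst ⁻¹' A) ≤
      P.real (Prod.snd ⁻¹' A') + P.real (Prod.fst ⁻¹' (A \ G)) + P.real (Prod.snd ⁻¹' Rgᶜ) +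
        P.real Clᶜ := by
    calc P.real (Prod.fst ⁻¹' A)
        ≤ P.real (((Prod.snd ⁻¹' A' ∪ Prod.fst ⁻¹' (A \ G)) ∪ Prod.snd ⁻¹' Rgᶜ) ∪ Clᶜ) :=
          measureReal_mono hsub
      _ ≤ P.real ((Prod.snd ⁻¹' A' ∪ Prod.fst ⁻¹' (A \ G)) ∪ Prod.snd ⁻¹' Rgᶜ) + P.real Clᶜ :=
          measureReal_union_le _ _
      _ ≤ P.real (Prod.snd ⁻¹' A' ∪ Prod.fst ⁻¹' (A \ G)) + P.real (Prod.snd ⁻¹' Rgᶜ) +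
            P.real Clᶜ := by
          gcongr
          exact measureReal_union_le _ _
      _ ≤ P.real (Prod.snd ⁻¹' A') + P.real (Prod.fst ⁻¹' (A \ G)) + P.real (Prod.snd ⁻¹' Rgᶜ) +
            P.real Clᶜ := by
          gcongr
          exact measureReal_union_le _ _
  rw [hPA, hPA'] at hbound
  linarith

/-! ### Small meshes make the printed bound `C δ^c` small -/

/-- For `c, C > 0` and `ε' > 0` there is `δ₂ > 0` with `C δ^c < ε'` for all `δ ∈ (0, δ₂)`.
[folklore] -/
theorem exists_pos_forall_mul_rpow_lt {c C ε' : ℝ} (hc : 0 < c) (hC : 0 < C) (hε' : 0 < ε') :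
    ∃ δ₂ : ℝ, 0 < δ₂ ∧ ∀ δ ∈ Set.Ioo (0 : ℝ) δ₂, C * δ ^ c < ε' := by
  refine ⟨(ε' / (2 * C)) ^ (1 / c), Real.rpow_pos_of_pos (by positivity) _, fun δ hδ => ?_⟩
  have hδc : δ ^ c ≤ ((ε' / (2 * C)) ^ (1 / c)) ^ c :=
    Real.rpow_le_rpow hδ.1.le hδ.2.le hc.le
  rw [← Real.rpow_mul (by positivity), one_div_mul_cancel hc.ne', Real.rpow_one] at hδc
  calc C * δ ^ c ≤ C * (ε' / (2 * C)) := by gcongr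
    _ = ε' / 2 := by field_simp
    _ < ε' := by linarith

/-! ### The reduction -/

/-- **DKKMO Cor. 1.3 at `q = 1` from Theorem 1.2 (`d_CN` form) and a deterministic transfer.**
Suppose that for every quad `R` and `ε > 0` there are a closeness level `η > 0` and `δ₁ > 0` such
that for every rotation `Q = e^{iβ}R` of `R`, every angle `α` and every mesh `δ ∈ (0, δ₁)` there
are events `G` ("`ω` crosses `Q` robustly and regularly": crossing cluster inside the window
`B(0, 1/η)`, no almost-crossing of the dual kind, …) and `Rg` ("`ω'` is regular near `e^{-iα}Q`")
with

* `P_{1/2}[𝒞_δ(Q) ∖ G] ≤ ε` and `P_{1/2}[Rgᶜ] ≤ ε` (Schramm–Smirnov-type continuity of `𝒞(Q)` and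
  arm estimates for bond percolation on `δℤ²`; the bounds must be uniform over `β` and `α`, which
  RSW inputs in round annuli provide), and
* (deterministic transfer) for all configurations `ω`, `ω'`: if `ω` crosses `Q` at mesh `δ`,
  `ω ∈ G`, `ω' ∈ Rg`, and the typed loop configurations of `ω` on `δℤ²` and of `ω'` on `e^{iα}δℤ²`
  satisfy `d_CN ≤ η` (`LoopConfig.IsClose η`, DKKMO §1.2), then `ω'` crosses `e^{-iα}Q` at mesh
  `δ` (equivalently, `ω'` drawn on `e^{iα}δℤ²` crosses `Q`).

Then DKKMO's Theorem 1.2 in its printed `d_CN` form (`dkkmo_theorem_1_2`: couplings of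
`φ_{δℤ²}` and `φ_{e^{iα}δℤ²}` with `ℙ[¬ (d_CN ≤ ε')] < ε'` for `ε' > C δ^c`, all `α ∈ [0, 2π]`)
implies `dkkmo_crossing_rotation_invariance`: by `quadCrossingProb_le_of_transfer` with `ε/3` for
each error term and `ε' = min η (ε/3)`, the crossing probability of every rotation of `R` drops by
at most `ε` under every further rotation once `δ < min δ₁ δ₂` (`C δ₂^c < ε'`,
`exists_pos_forall_mul_rpow_lt`), and the one-sided bound suffices
(`dkkmo_crossing_rotation_invariance_of_lower_bound`). This is the assembly of the printed proof
of Cor. 1.3 (§7.1, p. 43: "follows directly from Theorem 1.2 and the measurability of `𝒞(Q)` in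
the Schramm–Smirnov topology"), with the implication "`d_CN`-close ⟹ same crossing of the fixed
quad off a small event" (§5, p. 25, after Camia–Newman 2006) isolated as the hypothesis `H`; no
measurability of `G`, `Rg` is required.
[cite: DKKMO2020Rotational, Cor. 1.3 (q = 1), proof §7.1 p. 43; Thm. 1.2] -/
theorem dkkmo_crossing_rotation_invariance_of_transfer
    (H : ∀ (R : ConformalRectangle) (ε : ℝ), 0 < ε → ∃ η : ℝ, 0 < η ∧ ∃ δ₁ : ℝ, 0 < δ₁ ∧
      ∀ (β α : ℝ), ∀ δ ∈ Set.Ioo (0 : ℝ) δ₁, ∃ G Rg : Set (BondConfig (Site 2)),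
        (bondPercolation (zdGraph 2) half).real (quadCrossing (rotateQuad β R) δ \ G) ≤ ε ∧
        (bondPercolation (zdGraph 2) half).real Rgᶜ ≤ ε ∧
        ∀ ω ω' : BondConfig (Site 2), ω ∈ quadCrossing (rotateQuad β R) δ → ω ∈ G → ω' ∈ Rg →
          LoopConfig.IsClose η (bondLoopConfig δ 0 ω) (bondLoopConfig δ α ω') →
          ω' ∈ quadCrossing (rotateQuad (-α) (rotateQuad β R)) δ)
    (h12 : dkkmo_theorem_1_2) :
    dkkmo_crossing_rotation_invariance := by
  refine dkkmo_crossing_rotation_invariance_of_lower_bound fun R ε hε => ?_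
  have hε3 : 0 < ε / 3 := by positivity
  obtain ⟨η, hη, δ₁, hδ₁, hH⟩ := H R (ε / 3) hε3
  obtain ⟨c, C, hc, hC, hcoup⟩ := h12.exists_coupling
  set ε' : ℝ := min η (ε / 3) with hε'def
  have hε' : 0 < ε' := lt_min hη hε3
  have hε'η : ε' ≤ η := min_le_left _ _
  have hε'3 : ε' ≤ ε / 3 := min_le_right _ _
  obtain ⟨δ₂, hδ₂, hsmall⟩ := exists_pos_forall_mul_rpow_lt hc hC hε'
  refine ⟨min δ₁ δ₂, lt_min hδ₁ hδ₂, fun β α hα δ hδ => ?_⟩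
  have hδ1 : δ ∈ Set.Ioo (0 : ℝ) δ₁ := ⟨hδ.1, hδ.2.trans_le (min_le_left _ _)⟩
  have hδ2 : δ ∈ Set.Ioo (0 : ℝ) δ₂ := ⟨hδ.1, hδ.2.trans_le (min_le_right _ _)⟩
  obtain ⟨P, h1, h2, hP⟩ := hcoup α hα δ hδ.1 ε' (hsmall δ hδ2)
  obtain ⟨G, Rg, hG, hRg, htr⟩ := hH β α δ hδ1
  have key := quadCrossingProb_le_of_transfer hδ.1 hε' hε'η G Rg htr P h1 h2 hP
  linarith

end Literature.Probability.Percolation
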